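import Summits.AtomisticToContinuum.HydrodynamicLimit.Theorems.LambertianContactSwapLambertianEulerMarkedKorolyuk
import HarnessLib

/-!
# Cellwise fresh / non-fresh charging of the Lambertian collision sequence: the counting lemma
# (`LambertianContactSwap.LambertianEuler`, stmt-AtomisticToContinuum-11854, line `Sketch`; lead c10,
# piece W7 `CellCharging`, part 1 of 4: registered helper stub `sub_le_card_add_three_mul_card`)

The purely combinatorial core of the pathwise cell-charging inequality
`…CellCharging.windowCount_le_cellShells_add_marks`.  Collisions `k₁ ≤ m < K` of the Lambertian
collision sequence carry a colliding pair `p m` of two distinct particles and a cell index `cell m`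
(the cell of the collision time), nondecreasing in `m`.  A collision is FRESH if no earlier collision
of its cell involves one of its two particles; fresh collisions are charged injectively to
`(cell m, p m)` (in the application: a shell pair at the start of the cell).  A NON-FRESH collision
`m` has a particle `a ∈ p m` that collided last (in the cell, among collisions involving a particle of
`p m`) at `m' < m`, with partner `b`; both `a` and the other particle of `p m` are then free strictly
between `m'` and `m`.  Two patterns: (B1) `b` is also free strictly between `m'` and `m` — in the
application `m` is then MARKED (a third particle `b` near `a`, or a fast re-collision of the pair);
(B2) `b` collides first again at `m'' ∈ (m', m)`, necessarily without `a` — then `m''` is marked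
(`a` is a third particle near `b`).  The charging `m ↦ m` (B1), `m ↦ m''` (B2) has fibres of size at
most `3`: from `m''` and the choice of `b ∈ p m''` one recovers `m'` (the last collision of `b` before
`m''`), `a` (its partner there) and `m` (the next collision of `a`).  Hence
`K - k₁ ≤ #S + 3 #T` (`sub_le_card_add_three_mul_card`, via `Finset.card_le_card_of_injOn` and
`Finset.card_le_card_of_forall_subsingleton`).

References: Cercignani–Illner–Pulvirenti, *The Mathematical Theory of Dilute Gases* (1994), App. 4.A
(collision-by-collision construction).  All statements [folklore].
-/

noncomputable section

namespace Summit.AtomisticToContinuum.HydrodynamicLimit.Theorems.LambertianContactSwapLambertianEulerCellChargingCount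

open scoped BigOperators
open Set

/-! ## The counting lemma -/

/-- **Counting lemma of the cell charging** (registered helper stub of lead c10's piece W7).
Collisions `k₁ ≤ m < K` carry a pair `p m` (`(p m).1 ≠ (p m).2`) and a cell `cell m`, nondecreasing
in `m`.  If every FRESH collision `m` (no earlier collision `m'` of the same cell involves a particle
of `p m`) has `(cell m, p m) ∈ S`, and the two non-fresh patterns are marked in `T` — (B1): `a ∈ p m`
took part in `m' < m` (same cell) with partner `b`, and `a`, `b` take part in no collision strictly
between `m'` and `m` ⟹ `m ∈ T`; (B2): `{a, b} = p m'`, `b ∈ p m`, `a ∉ p m`, same cell, `a`, `b` free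
strictly between ⟹ `m ∈ T` — then `K - k₁ ≤ #S + 3 #T`. [folklore] -/
theorem sub_le_card_add_three_mul_card :
    ∀ {α : Type} {k₁ K : ℕ} (cell : ℕ → ℕ) (p : ℕ → α × α) (S : Finset (ℕ × (α × α))) (T : Finset ℕ),
      (∀ m₁ m₂, k₁ ≤ m₁ → m₁ ≤ m₂ → m₂ < K → cell m₁ ≤ cell m₂) →
      (∀ m, k₁ ≤ m → m < K → (p m).1 ≠ (p m).2) →
      (∀ m, k₁ ≤ m → m < K →
        (∀ m', k₁ ≤ m' → m' < m → cell m' = cell m →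
          (p m).1 ≠ (p m').1 ∧ (p m).1 ≠ (p m').2 ∧ (p m).2 ≠ (p m').1 ∧ (p m).2 ≠ (p m').2) →
        (cell m, p m) ∈ S) →
      (∀ m' m a b, k₁ ≤ m' → m' < m → m < K → cell m' = cell m →
        (a = (p m').1 ∧ b = (p m').2 ∨ a = (p m').2 ∧ b = (p m').1) → (a = (p m).1 ∨ a = (p m).2) →
        (∀ k, m' < k → k < m → a ≠ (p k).1 ∧ a ≠ (p k).2) →
        (∀ k, m' < k → k < m → b ≠ (p k).1 ∧ b ≠ (p k).2) → m ∈ T) →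
      (∀ m' m a b, k₁ ≤ m' → m' < m → m < K → cell m' = cell m →
        (a = (p m').1 ∧ b = (p m').2 ∨ a = (p m').2 ∧ b = (p m').1) → (b = (p m).1 ∨ b = (p m).2) →
        a ≠ (p m).1 → a ≠ (p m).2 →
        (∀ k, m' < k → k < m → a ≠ (p k).1 ∧ a ≠ (p k).2) →
        (∀ k, m' < k → k < m → b ≠ (p k).1 ∧ b ≠ (p k).2) → m ∈ T) →
      K - k₁ ≤ S.card + 3 * T.card := by
  intro α k₁ K cell p S T hmono hne hS h1 h2
  classical
  -- `part a k`: particle `a` takes part in collision `k`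
  obtain ⟨part, hpart⟩ : ∃ part : α → ℕ → Prop, ∀ a k, part a k ↔ a = (p k).1 ∨ a = (p k).2 :=
    ⟨_, fun _ _ => Iff.rfl⟩
  have hnpart : ∀ a k, ¬part a k ↔ a ≠ (p k).1 ∧ a ≠ (p k).2 := fun a k => by rw [hpart, not_or]
  -- fresh collisions
  obtain ⟨fresh, hfresh⟩ : ∃ fresh : ℕ → Prop, ∀ m, fresh m ↔
      ∀ m', k₁ ≤ m' → m' < m → cell m' = cell m → ¬part (p m).1 m' ∧ ¬part (p m).2 m' :=
    ⟨_, fun _ => Iff.rfl⟩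
  set C := Finset.Ico k₁ K with hC
  -- (A) the fresh collisions inject into `S`
  have hA : (C.filter fresh).card ≤ S.card := by
    refine Finset.card_le_card_of_injOn (fun m => (cell m, p m)) (fun m hm => ?_) ?_
    · rw [Finset.coe_filter, Set.mem_setOf_eq, hC, Finset.mem_Ico] at hm
      refine hS m hm.1.1 hm.1.2 fun m' h1' h2' h3' => ?_
      have h := (hfresh m).1 hm.2 m' h1' h2' h3'
      exact ⟨((hnpart _ _).1 h.1).1, ((hnpart _ _).1 h.1).2, ((hnpart _ _).1 h.2).1,
        ((hnpart _ _).1 h.2).2⟩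
    · intro m₁ hm₁ m₂ hm₂ heq
      rw [Finset.coe_filter, Set.mem_setOf_eq, hC, Finset.mem_Ico] at hm₁ hm₂
      simp only [Prod.mk.injEq] at heq
      by_contra hneq
      rcases lt_or_gt_of_ne hneq with hlt | hlt
      · exact ((hfresh m₂).1 hm₂.2 m₁ hm₁.1.1 hlt heq.1).1 ((hpart _ _).2 (Or.inl (by rw [heq.2])))
      · exact ((hfresh m₁).1 hm₁.2 m₂ hm₂.1.1 hlt heq.1.symm).1
          ((hpart _ _).2 (Or.inl (by rw [heq.2])))
  -- the decoding relation of pattern (B2): `b` collided last at `m'` before `d`, its partner `a`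
  -- there collides next at `m`
  obtain ⟨Q, hQ⟩ : ∃ Q : ℕ → ℕ → α → Prop, ∀ m d b, Q m d b ↔ ∃ m' a, k₁ ≤ m' ∧ m' < d ∧ d < m ∧
      (a = (p m').1 ∧ b = (p m').2 ∨ a = (p m').2 ∧ b = (p m').1) ∧ part a m ∧
      (∀ k, m' < k → k < m → ¬part a k) ∧ (∀ k, m' < k → k < d → ¬part b k) :=
    ⟨_, fun _ _ _ => Iff.rfl⟩
  have hQuniq : ∀ b d m₁ m₂, m₁ < K → Q m₁ d b → Q m₂ d b → m₁ = m₂ := by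
    intro b d m₁ m₂ hm₁K hq₁ hq₂
    obtain ⟨n₁, a₁, hk₁, hn₁d, hdm₁, hpair₁, hpa₁, hfa₁, hfb₁⟩ := (hQ _ _ _).1 hq₁
    obtain ⟨n₂, a₂, -, hn₂d, hdm₂, hpair₂, hpa₂, hfa₂, hfb₂⟩ := (hQ _ _ _).1 hq₂
    -- the last collision of `b` before `d` is the same
    have hpb : ∀ {n} {a' : α}, (a' = (p n).1 ∧ b = (p n).2 ∨ a' = (p n).2 ∧ b = (p n).1) → part b n :=
      fun h => by rcases h with ⟨-, h⟩ | ⟨-, h⟩ <;> [exact (hpart _ _).2 (Or.inr h);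
        exact (hpart _ _).2 (Or.inl h)]
    have hpb₁ := hpb hpair₁
    have hpb₂ := hpb hpair₂
    have hn : n₁ = n₂ := by
      by_contra h
      rcases lt_or_gt_of_ne h with hlt | hlt
      · exact hfb₁ n₂ hlt hn₂d hpb₂
      · exact hfb₂ n₁ hlt hn₁d hpb₁
    subst hn
    -- so is the partner `a` of `b` in it
    have hpne := hne n₁ hk₁ (by omega)
    have ha : a₁ = a₂ := by
      rcases hpair₁ with ⟨h₁, h₂⟩ | ⟨h₁, h₂⟩ <;> rcases hpair₂ with ⟨h₃, h₄⟩ | ⟨h₃, h₄⟩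
      · rw [h₁, h₃]
      · exact absurd (h₄.symm.trans h₂) hpne
      · exact absurd (h₂.symm.trans h₄) hpne
      · rw [h₁, h₃]
    subst ha
    -- and `m` is the next collision of `a`
    by_contra h
    rcases lt_or_gt_of_ne h with hlt | hlt
    · exact hfa₂ m₁ (by omega) hlt hpa₁
    · exact hfa₁ m₂ (by omega) hlt hpa₂
  -- (B) the non-fresh collisions are charged to `T × {0, 1, 2}` with subsingleton fibres
  have hB : (C.filter fun m => ¬fresh m).card ≤ (T ×ˢ Finset.range 3).card := by
    refine Finset.card_le_card_of_forall_subsingleton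
      (fun m di => (di.2 = 0 ∧ di.1 = m) ∨ (di.2 = 1 ∧ Q m di.1 (p di.1).1) ∨
        (di.2 = 2 ∧ Q m di.1 (p di.1).2)) ?_ ?_
    · -- every non-fresh collision is charged to a marked one
      intro m hm
      rw [Finset.mem_filter, hC, Finset.mem_Ico] at hm
      obtain ⟨⟨hk₁m, hmK⟩, hnf⟩ := hm
      -- the last earlier collision `m'` of the cell involving a particle of `p m`
      set W := (Finset.Ico k₁ m).filter fun k => cell k = cell m ∧ (part (p m).1 k ∨ part (p m).2 k)
        with hW
      have hWne : W.Nonempty := by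
        rw [hfresh] at hnf
        push Not at hnf
        obtain ⟨m', h1', h2', h3', h4'⟩ := hnf
        refine ⟨m', ?_⟩
        rw [hW, Finset.mem_filter, Finset.mem_Ico]
        refine ⟨⟨h1', h2'⟩, h3', ?_⟩
        by_contra h
        rw [not_or] at h
        exact h.2 (h4' h.1)
      obtain ⟨m', hm'W, hmax⟩ : ∃ m', m' ∈ W ∧ ∀ k ∈ W, k ≤ m' :=
        ⟨W.max' hWne, Finset.max'_mem W hWne, fun k hk => Finset.le_max' W k hk⟩
      rw [hW, Finset.mem_filter, Finset.mem_Ico] at hm'W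
      obtain ⟨⟨hk₁m', hm'm⟩, hcell', hpm'⟩ := hm'W
      -- a particle `a` of `p m` taking part in `m'`
      obtain ⟨a, ham, ham'⟩ : ∃ a, part a m ∧ part a m' := by
        rcases hpm' with h | h
        · exact ⟨(p m).1, (hpart _ _).2 (Or.inl rfl), h⟩
        · exact ⟨(p m).2, (hpart _ _).2 (Or.inr rfl), h⟩
      -- `a` is free strictly between `m'` and `m`
      have hfa : ∀ k, m' < k → k < m → ¬part a k := by
        intro k hk1 hk2 hk
        have hcellk : cell k = cell m :=
          le_antisymm (hmono k m (by omega) hk2.le hmK)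
            (hcell' ▸ hmono m' k hk₁m' hk1.le (by omega))
        have hk' : part (p m).1 k ∨ part (p m).2 k := by
          rcases (hpart _ _).1 ham with h | h
          · exact Or.inl (h ▸ hk)
          · exact Or.inr (h ▸ hk)
        have hle := hmax k (by
          rw [hW, Finset.mem_filter, Finset.mem_Ico]
          exact ⟨⟨by omega, hk2⟩, hcellk, hk'⟩)
        omega
      -- its partner `b` in the collision `m'`
      obtain ⟨b, hab⟩ : ∃ b, a = (p m').1 ∧ b = (p m').2 ∨ a = (p m').2 ∧ b = (p m').1 := by
        rcases (hpart _ _).1 ham' with h | h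
        · exact ⟨(p m').2, Or.inl ⟨h, rfl⟩⟩
        · exact ⟨(p m').1, Or.inr ⟨h, rfl⟩⟩
      by_cases hB1 : ∀ k, m' < k → k < m → ¬part b k
      · -- (B1): `m` itself is marked
        have hmT : m ∈ T := h1 m' m a b hk₁m' hm'm hmK hcell' hab ((hpart _ _).1 ham)
          (fun k hk1 hk2 => (hnpart a k).1 (hfa k hk1 hk2))
          (fun k hk1 hk2 => (hnpart b k).1 (hB1 k hk1 hk2))
        exact ⟨(m, 0), Finset.mem_product.2 ⟨hmT, by simp⟩, Or.inl ⟨rfl, rfl⟩⟩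
      · -- (B2): the first later collision `d` of `b` is marked
        push Not at hB1
        obtain ⟨k₀, hk₀1, hk₀2, hk₀b⟩ := hB1
        set V := (Finset.Ioo m' m).filter fun k => part b k with hV
        have hVne : V.Nonempty :=
          ⟨k₀, by rw [hV, Finset.mem_filter, Finset.mem_Ioo]; exact ⟨⟨hk₀1, hk₀2⟩, hk₀b⟩⟩
        obtain ⟨d, hdV, hmin⟩ : ∃ d, d ∈ V ∧ ∀ k ∈ V, d ≤ k :=
          ⟨V.min' hVne, Finset.min'_mem V hVne, fun k hk => Finset.min'_le V k hk⟩
        rw [hV, Finset.mem_filter, Finset.mem_Ioo] at hdV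
        obtain ⟨⟨hm'd, hdm⟩, hbd⟩ := hdV
        have hfb : ∀ k, m' < k → k < d → ¬part b k := by
          intro k hk1 hk2 hk
          have hle := hmin k (by
            rw [hV, Finset.mem_filter, Finset.mem_Ioo]
            exact ⟨⟨hk1, by omega⟩, hk⟩)
          omega
        have hcelld : cell m' = cell d :=
          le_antisymm (hmono m' d hk₁m' hm'd.le (by omega))
            ((hmono d m (by omega) hdm.le hmK).trans hcell'.symm.le)
        have had : ¬part a d := hfa d hm'd hdm
        have hdT : d ∈ T := h2 m' d a b hk₁m' hm'd (by omega) hcelld hab ((hpart _ _).1 hbd)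
          ((hnpart a d).1 had).1 ((hnpart a d).1 had).2
          (fun k hk1 hk2 => (hnpart a k).1 (hfa k hk1 (by omega)))
          (fun k hk1 hk2 => (hnpart b k).1 (hfb k hk1 hk2))
        have hq : Q m d b := (hQ _ _ _).2 ⟨m', a, hk₁m', hm'd, hdm, hab, ham, hfa, hfb⟩
        rcases (hpart _ _).1 hbd with hb | hb
        · exact ⟨(d, 1), Finset.mem_product.2 ⟨hdT, by simp⟩, Or.inr (Or.inl ⟨rfl, hb ▸ hq⟩)⟩
        · exact ⟨(d, 2), Finset.mem_product.2 ⟨hdT, by simp⟩, Or.inr (Or.inr ⟨rfl, hb ▸ hq⟩)⟩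
    · -- the fibres of the charging relation are subsingletons
      rintro ⟨d, i⟩ - m₁ hm₁ m₂ hm₂
      rw [Set.mem_setOf_eq, Finset.mem_filter, hC, Finset.mem_Ico] at hm₁ hm₂
      obtain ⟨⟨⟨-, hm₁K⟩, -⟩, hr₁⟩ := hm₁
      obtain ⟨-, hr₂⟩ := hm₂
      dsimp only at hr₁ hr₂
      rcases hr₁ with ⟨hi₁, hd₁⟩ | ⟨hi₁, hq₁⟩ | ⟨hi₁, hq₁⟩ <;>
        rcases hr₂ with ⟨hi₂, hd₂⟩ | ⟨hi₂, hq₂⟩ | ⟨hi₂, hq₂⟩ <;>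
        first
        | omega
        | exact hd₁.symm.trans hd₂
        | exact hQuniq _ _ _ _ hm₁K hq₁ hq₂
  calc K - k₁ = C.card := by rw [hC, Nat.card_Ico]
    _ = (C.filter fresh).card + (C.filter fun m => ¬fresh m).card :=
      (Finset.card_filter_add_card_filter_not _).symm
    _ ≤ S.card + (T ×ˢ Finset.range 3).card := add_le_add hA hB
    _ = S.card + 3 * T.card := by rw [Finset.card_product, Finset.card_range, mul_comm]

end Summit.AtomisticToContinuum.HydrodynamicLimit.Theorems.LambertianContactSwapLambertianEulerCellChargingCount

end
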